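import Summits.QuantumFields.YangMills.Theorems.UnitScaleTiltFluctuationComparisonRegPrInteriorChi
import Summits.QuantumFields.YangMills.Theorems.UnitScaleTiltFluctuationComparisonRegPrRepAtHeightsSocketOnPrintChi
import Literature.MathematicalPhysics.QuantumFieldTheory.Balaban1983to89.T3LowerAlongMinimisersSplit
import Summits.QuantumFields.YangMills.Theorems.AlphaInputsT3ACMinimiserPinThm1
import HarnessLib

/-!
# `UnitScaleTiltFluctuationComparisonRegPrIntLOnChi` — THE RECORD-FREE §2 ENGINE OF THE R-57χ SKELETON (v5kC) FOR THE RE-TYPED ITEM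
# `FluctuationComparisonRegPrIntL` (stmt-QuantumFields-20520): «(41)∧(47) ON PRINT'S χ OF THE DATUM'S OWN MINIMISER + King's Cauchy property on χ-good data
# + [Balaban1985Variational] Thm 1 WITH ITS (8)-CLAUSE FOR EVERY MINIMISER ⟹ the interior comparison», at EVERY odd block size, with ONE chain

Cell `ym3-torus`, width-lever lane `ym-ust-19935-r1` g3 (strategy (R1) «print's characteristic function χ_k of [Balaban1985UV3] (47) back»; successor of g0/g2).
Count-neutral helper (`--supports stmt-QuantumFields-20520`); registry untouched; no numerics; nothing of [Balaban1985UV3]/[King1986]/[Balaban1985Variational] is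
asserted — every row enters as a hypothesis schema already typed in the tree.

WHY (OWNER RULING g23-№2 «R-57χ» + ADDENDA 1–6, finding F-r1-g2-1).  The lane-records stub 2′ of skeleton v5k feeds conjunct (A) `RepAtHeights` on the WHOLE sharp
window through the lower one-step envelope row R3D-02, refuted on the edge band at `L ∈ {3,5}` (FINDING #44); the repair re-types the lower row with print's `χ_k`
— the window ON THE MINIMISER `U_k(V)` of (47) p.267 — on the left and inside, so that the re-typed record delivers (A) only ON print's χ:
`PrintChi.TwoSidedRepOn F γ b₀ p₀ (atHeights (printChiSets D b₀ p₀)) ε₀ …` (★r1 g2's sockets `LogComparisonRepAtHeightsOn.twoSidedRepOn_of_oneStepTrivOn(_printChi)`,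
p545879/p546995).  The new skeleton's §2 must then run the WHOLE comparison chain on χ — at every block size, not only `L < 7` — and discharge the χ-guard on the
`c`-interior of the window where the item `FluctuationComparisonRegPrIntL` is asserted.  This file is that §2, BY NAME and RECORD-FREE: the definer's one-token
successors 2′χ / 3⁗χ / (i*)χ (ADD. 6: `OfV3chiAt`, `PkgAtV3chi`, `dataOfV3chi`) enter only through the datum-level interface `hData` of §4, i.e. through ONE thin adapter.

THE LOCATED POINT FOR THE PEN (new here).  Print's χ is a condition on THE DATUM'S OWN composite minimiser `D.Umin` (the re-typed row reads `1_{χ}` of `U_k(V)`,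
[Balaban1985UV3] (47) p.267), while the item's interior constant `c` is chosen per block size BEFORE the profile `(b₀, p₀)`.  Hence the discharge «`c`-interior ⇒
print's χ of `D.Umin`» can use NEITHER stub T's ∃-form `Thm1GlobalMinAt` (it produces SOME minimiser in (8); the tree carries no uniqueness) NOR the record's own
row r1 `uminTriv_mem_regFibrePr` (its constant `𝔠.B₃` is chosen after `(b₀, p₀)`).  What serves is [Balaban1985Variational] Thm 1 (8) in its ∀-form «EVERY minimiser
over (6)(ε₀) of an `ε₁`-small datum lies in (8)(B₃ε₁)» = `T3LowerAlongMinimisersSplit.MinimisersIn8At L a₀ a₁ B₃`, an OUTPUT of crux `MinimiserStabilityRegPr`'s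
registered leaves (`…MinimiserStabilityRegPrVariational.variational_of_leaves_log`: `MinSixAttainedAt ∧ MinimisersIn8At ∧ …`), exactly as today's stub T is
(`Thm1GlobalMinAt ⇐ MinSixAttainedAt ∧ MinimisersIn8At`, `…MinimiserPinThm1`).  §3 is that discharge; §4 asks the pair `Thm1GlobalMinAt ∧ MinimisersIn8At` at
block-size level (hypothesis `hT8`).

CONTENTS.
* §1 `twoSidedRepOn_anti`, `pintCauchyOn_anti` — the two χ-restricted schemas are antitone in the predicate.
* §2 `fluctuationComparisonRegPrIntAt_of_repOn_cauchyOn_interior` — per family: (41)∧(47) ON `S₁`, King's Cauchy property ON `S₂`, the `c`-interior inside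
  `S₁` and `S₂` for both runs a.e., positivity on the interior ⟹ `FluctuationComparisonRegPrIntAt F γ b₀ p₀ m c ε₀` (★p2 g14's `bgFluctuationIntAt_of_socketOn`,
  p539115, at `S := S₁ ∧ S₂`).
* §3 `atHeights_printChiSets_of_interior` — the discharge: `MinimisersIn8At L a₀ a₁ B₃`, the datum's `UminTrivIsRegMinimiser` clauses at heights `n < K`
  (v3: `AlphaInputsT3AC.dataOfV3_uminTriv`), `B₃c ≤ 1`, `c ≤ 1`, `cθBal ≤ a₁`, `B₃cθBal ≤ ε₀ ≤ a₀` ⟹ every datum of the `c`-interior at height `n < K` lies in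
  `atHeights (printChiSets D b₀ p₀) K n`: its reading is in the window and `D.Umin` of it has finest plaquettes `< B₃cθBal(n)η² ≤ θBal(n)η²` — print's `χ_k = 1`;
  `thm1In8_of_attained_of_in8` — §4's hypothesis `hT8` at one `L` from the shape crux `MinimiserStabilityRegPr`'s `variational_of_leaves_log` delivers
  (`MinSixAttainedAt L â₀ â₁ B₃ ∧ MinimisersIn8At L a₀ a₁ B₃`), at the common window.
* §4 `regPrIntL_of_dataOnPrintChi` — block-size level, the v5kC §2 body: window positivity (STUB 1 shape, `OneStepSubmersion.posOnSmall_of_oneStepSmallLift`),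
  `hT8` (Thm 1 ∃-form ∧ (8) ∀-form at every odd `L > 1`), and `hData` = for every odd `L > 1`, under the route's prefix, per family a datum `D : AlphaDataT3 F γ`
  with (a) the `UminTrivIsRegMinimiser` clauses at `n < K`, (b) (41)∧(47) ON print's χ `atHeights (printChiSets D b₀ p₀)`, (c) King's cut-off-Cauchy property of
  `D.PintH` ON the `ChiGood(μ_L)`-good data (`μ_L = 1 − 2/(L√L)`; (i*)χ + χ-S-E″ at `L < 7`, 3⁗χ + S-E″ + `pintCauchyOn_of_cauchyAt` at `L ≥ 7`)
  ⟹ `FluctuationComparisonRegPrIntL`, `c := (max B₃ 1)⁻¹`, `m₀ ≥ 2`; ONE chain for every odd `L`.  `regPrIntL_of_dataOnPrintChi_cauchyFull`: the same with the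
  full-window Cauchy property `CauchyAtHeights D b₀ p₀ m` in (c).

WHAT THIS IS NOT: not a proof of any stub; not a claim about [Balaban1985UV3]'s inequalities; the (t2) Gaussian-bulk half of the re-typed lower row (why the
fibre mass over a χ-good datum sits inside χ one level down) is the suppliers' analysis (NODE O), untouched here.

References: T. Bałaban, CMP 102 (1985) 255–275 [Balaban1985UV3] ((7) p.257, (41) p.266, (47) p.267, p.272); CMP 102 (1985) 277–309 [Balaban1985Variational]
(Thm 1 (8) p.279, Prop 7 p.299, Prop 8 p.304); C. King, CMP 102 (1986) 649–677 [King1986] (Thm 3.4 (3.9) p.656, Props 3.8–3.9 pp.664–665).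
-/

set_option autoImplicit false

noncomputable section

namespace Summit.QuantumFields.YangMills.Theorems.InteriorExcision

open MeasureTheory Filter
open Literature.MathematicalPhysics.QuantumFieldTheory.Balaban1983to89
open Literature.MathematicalPhysics.QuantumFieldTheory.Balaban1983to89.T3ContinuumYM3Torus
open Literature.MathematicalPhysics.QuantumFieldTheory.Balaban1983to89.T3LevelShift
open Literature.MathematicalPhysics.QuantumFieldTheory.Balaban1983to89.T3UnitLawDensityEML (ℰp measurableE_ℰp)
open Literature.MathematicalPhysics.QuantumFieldTheory.Balaban1983to89.T3UnitScaleTilt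
open Literature.MathematicalPhysics.QuantumFieldTheory.Balaban1983to89.T3RestrictedUnitDensity
open Literature.MathematicalPhysics.QuantumFieldTheory.Balaban1983to89.T3TiltDescent
open Literature.MathematicalPhysics.QuantumFieldTheory.Balaban1983to89.T3CruxEstimates
open Literature.MathematicalPhysics.QuantumFieldTheory.Balaban1983to89.T3RegularMinimiser
open Literature.MathematicalPhysics.QuantumFieldTheory.Balaban1983to89.T3PrintedRegularMinimiser
open Literature.MathematicalPhysics.QuantumFieldTheory.Balaban1983to89.T3PrintedMinimiserExistence
open Literature.MathematicalPhysics.QuantumFieldTheory.Balaban1983to89.T3MinimiserStabilityReduction (θBal_pos)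
open Literature.MathematicalPhysics.QuantumFieldTheory.Balaban1983to89.T3ThresholdSmallness (exists_forall_θBal_le)
open Literature.MathematicalPhysics.QuantumFieldTheory.Balaban1983to89.T3InteriorExcision
open Literature.MathematicalPhysics.QuantumFieldTheory.Balaban1983to89.T3LogComparisonSocket
open Literature.MathematicalPhysics.QuantumFieldTheory.Balaban1983to89.T3AlphaInputsAC
open Literature.MathematicalPhysics.QuantumFieldTheory.Balaban1983to89.T3LowerAlongMinimisersSplit (MinimisersIn8At)
open Literature.MathematicalPhysics.QuantumFieldTheory.Balaban1983to89.T3ExistSplit (MinSixAttainedAt)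
open Literature.MathematicalPhysics.QuantumFieldTheory.Balaban1983to89.Missing
open Summit.QuantumFields.YangMills.Theorems.PrintChi
open Summit.QuantumFields.YangMills.Theorems.LogComparisonRepAtHeightsOn (atHeights printChiSets)

/-! ## §1 The χ-restricted schemas are antitone in the predicate -/

section Anti

variable {F : T3Family} {γ b₀ p₀ ε₀ : ℝ} {m : ℕ}
  {S S' : (K n : ℕ) → n ≤ K → GaugeField (F.P n) 0 (Matrix.specialUnitaryGroup (Fin 2) ℂ) → Prop}
  {Pint : (K n : ℕ) → GaugeField (F.P n) 0 (Matrix.specialUnitaryGroup (Fin 2) ℂ) → ℝ} {E Rm : ℕ → ℕ → ℝ}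

/-- `PrintChi.TwoSidedRepOn` is ANTITONE in the predicate: asserted on `S`, it holds on every stronger `S'`. [cite: Balaban1985UV3, (47) p.267] -/
theorem twoSidedRepOn_anti (hSS' : ∀ K n h V, S' K n h V → S K n h V) (h : TwoSidedRepOn F γ b₀ p₀ S ε₀ Pint E Rm) :
    TwoSidedRepOn F γ b₀ p₀ S' ε₀ Pint E Rm := by
  obtain ⟨h0, hsum, hae⟩ := h
  refine ⟨h0, hsum, fun K n hn => ?_⟩
  filter_upwards [hae K n hn] with V hV
  exact fun hs hS' hpos => hV hs (hSS' _ _ _ _ hS') hpos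

/-- `PrintChi.PintCauchyOn` is ANTITONE in the predicate. [cite: King1986, Thm 3.4 (3.9) p.656] -/
theorem pintCauchyOn_anti (hSS' : ∀ K n h V, S' K n h V → S K n h V) (h : PintCauchyOn F γ b₀ p₀ S m Pint) :
    PintCauchyOn F γ b₀ p₀ S' m Pint := by
  obtain ⟨r', c, hr', hr'0, hae⟩ := h
  refine ⟨r', c, hr', hr'0, fun K => ?_⟩
  filter_upwards [hae K] with V hV
  exact fun hs h1 h2 hp hp' => hV hs (hSS' _ _ _ _ h1) (hSS' _ _ _ _ h2) hp hp'

end Anti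

/-! ## §2 Per family: representation on `S₁`, Cauchy on `S₂`, the interior inside both ⟹ the interior comparison -/

section Family

variable {F : T3Family} {γ b₀ p₀ ε₀ c : ℝ} {m : ℕ}

/-- **THE INTERIOR COMPARISON FROM TWO χ-RESTRICTED ROWS.**  For one family: [Balaban1985UV3] (41)∧(47) pinned, asserted on data satisfying `S₁`
(`TwoSidedRepOn S₁`; to be print's χ of the datum's minimiser read at the heights), King's cut-off-Cauchy property of the interaction sums asserted on doubly-`S₂`
data (`PintCauchyOn S₂`; to be the `ChiGood(μ)`-good data of (i*)χ, or everything), the `c`-interior of the window inside `S₁` and inside `S₂` for BOTH runs a.e.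
(steps `K ≥ 1`), `θBal(c·b₀) ≤ θBal(b₀)`, and positivity of both restricted densities on the interior ⟹ `FluctuationComparisonRegPrIntAt F γ b₀ p₀ m c ε₀` —
`bgFluctuationIntAt_of_socketOn` at `S := S₁ ∧ S₂` through §1. [cite: King1986, Prop. 3.8-3.9 pp.664-665] -/
theorem fluctuationComparisonRegPrIntAt_of_repOn_cauchyOn_interior (hm : 0 < m)
    (S₁ S₂ : (K n : ℕ) → n ≤ K → GaugeField (F.P n) 0 (Matrix.specialUnitaryGroup (Fin 2) ℂ) → Prop)
    {Pint : (K n : ℕ) → GaugeField (F.P n) 0 (Matrix.specialUnitaryGroup (Fin 2) ℂ) → ℝ} {E Rm : ℕ → ℕ → ℝ}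
    (hrep : TwoSidedRepOn F γ b₀ p₀ S₁ ε₀ Pint E Rm) (hcauchy : PintCauchyOn F γ b₀ p₀ S₂ m Pint)
    (hcθ : ∀ i, θBal F.L γ (c * b₀) p₀ i ≤ θBal F.L γ b₀ p₀ i)
    (hS₁ : ∀ K, 0 < K → ∀ᵐ V ∂fieldMeasure (F.P (K / m)) 0 (Matrix.specialUnitaryGroup (Fin 2) ℂ),
      PlaqSmall (θBal F.L γ (c * b₀) p₀ (K / m)) V →
        S₁ K (K / m) (Nat.div_le_self K m) V ∧ S₁ (K + 1) (K / m) ((Nat.div_le_self K m).trans (Nat.le_succ K)) V)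
    (hS₂ : ∀ K, 0 < K → ∀ᵐ V ∂fieldMeasure (F.P (K / m)) 0 (Matrix.specialUnitaryGroup (Fin 2) ℂ),
      PlaqSmall (θBal F.L γ (c * b₀) p₀ (K / m)) V →
        S₂ K (K / m) (Nat.div_le_self K m) V ∧ S₂ (K + 1) (K / m) ((Nat.div_le_self K m).trans (Nat.le_succ K)) V)
    (hposI : ∀ K, 0 < K → ∀ᵐ V ∂fieldMeasure (F.P (K / m)) 0 (Matrix.specialUnitaryGroup (Fin 2) ℂ),
      PlaqSmall (θBal F.L γ (c * b₀) p₀ (K / m)) V →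
        0 < heightDensity F γ (Nat.div_le_self K m) (histGood F ℰp (θBal F.L γ b₀ p₀) K (K / m)) V ∧
        0 < heightDensity F γ ((Nat.div_le_self K m).trans (Nat.le_succ K)) (histGood F ℰp (θBal F.L γ b₀ p₀) (K + 1) (K / m)) V) :
    FluctuationComparisonRegPrIntAt F γ b₀ p₀ m c ε₀ := by
  refine bgFluctuationIntAt_of_socketOn hm (fun K n h V => S₁ K n h V ∧ S₂ K n h V)
    (twoSidedRepOn_anti (fun _ _ _ _ h => h.1) hrep) (pintCauchyOn_anti (fun _ _ _ _ h => h.2) hcauchy) hcθ (fun K hK => ?_) hposI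
  filter_upwards [hS₁ K hK, hS₂ K hK] with V h1 h2
  exact fun hs => ⟨⟨(h1 hs).1, (h2 hs).1⟩, (h1 hs).2, (h2 hs).2⟩

end Family

/-! ## §3 The discharge: the `c`-interior lies in print's χ OF THE DATUM'S OWN MINIMISER, from Thm 1 (8) for every minimiser -/

section Discharge

variable {F : T3Family} {γ b₀ p₀ ε₀ c : ℝ}

/-- **THE `c`-INTERIOR IS PRINT-χ-GOOD FOR THE DATUM'S OWN COMPOSITE MINIMISER.**  Let [Balaban1985Variational] Thm 1 (8) hold in its ∀-form at block size `L`
(`MinimisersIn8At L a₀ a₁ B₃`: every minimiser of the Wilson action over print's space (6)(ε₀) of an `ε₁`-small datum lies in (8)(B₃ε₁), for `0 < ε₁ ≤ a₁`,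
`B₃ε₁ ≤ ε₀ ≤ a₀`), let the datum `D`'s trivial-history composite minimiser at every height `n < K` of every window datum lie in (6)(ε₀) and attain the regular
minimum (the `UminTrivIsRegMinimiser` clauses; v3: `AlphaInputsT3AC.dataOfV3_uminTriv`), and let `c ≤ 1`, `B₃c ≤ 1`, `θBal(c·b₀) ≤ a₁`, `B₃θBal(c·b₀) ≤ ε₀ ≤ a₀`
(coupling below a threshold).  Then every datum `V` of the `c`-interior `PlaqSmall (θBal(c·b₀) n) V`, `n < K`, lies in `atHeights (printChiSets D b₀ p₀) K n`: its
reading is in the window, and `D.Umin` of it — a minimiser, hence in (8) at `ε₁ := c·θBal(n)` — has finest plaquettes `< B₃cθBal(n)η^{2(K−n)} ≤ θBal(n)η^{2(K−n)}`,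
print's «|U_k(∂p) − 1| < g_kp(g_k)η²» of (47). [cite: Balaban1985Variational, Thm 1 (8) p.279; Balaban1985UV3, (47) p.267] -/
theorem atHeights_printChiSets_of_interior {L : ℕ} {a₀ a₁ B₃ : ℝ} (hIn8 : MinimisersIn8At L a₀ a₁ B₃) (hF : F.L = L)
    (hγ : 0 < γ) (hγ1 : γ ≤ 1) (hb : 0 < b₀) (hc0 : 0 < c) (hc1 : c ≤ 1) (hcB : B₃ * c ≤ 1) (hε₀a : ε₀ ≤ a₀)
    (hθa₁ : ∀ i, θBal F.L γ (c * b₀) p₀ i ≤ a₁) (hθε₀ : ∀ i, B₃ * θBal F.L γ (c * b₀) p₀ i ≤ ε₀)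
    {D : AlphaDataT3 F γ}
    (hU : ∀ (K n : ℕ) (hnK : n < K) (V : GaugeField (F.P n) 0 (Matrix.specialUnitaryGroup (Fin 2) ℂ)),
      PlaqSmall (θBal F.L γ b₀ p₀ n) V →
        D.Umin K (K - n) (D.triv K (K - n))
            (fieldShift (F.sitesPerDir_eq (m := F.m) (K := K) (j := K - n) (m' := F.m) (K' := n) (j' := 0) (by omega)) V) ∈
          regFibrePr F n K hnK.le ε₀ V ∧
        wilsonAction4 (D.Umin K (K - n) (D.triv K (K - n))
            (fieldShift (F.sitesPerDir_eq (m := F.m) (K := K) (j := K - n) (m' := F.m) (K' := n) (j' := 0) (by omega)) V)) =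
          minActionRegPr F n K hnK.le ε₀ V)
    {n K : ℕ} (hnK : n < K) (V : GaugeField (F.P n) 0 (Matrix.specialUnitaryGroup (Fin 2) ℂ))
    (hV : PlaqSmall (θBal F.L γ (c * b₀) p₀ n) V) :
    atHeights (printChiSets D b₀ p₀) K n hnK.le V := by
  have hL : 1 ≤ F.L := F.hL.2.le
  have hcθ : θBal F.L γ (c * b₀) p₀ n ≤ θBal F.L γ b₀ p₀ n := θBal_mul_le hL hγ hγ1 hb hc1 p₀ n
  have hVw : PlaqSmall (θBal F.L γ b₀ p₀ n) V := fun q => (hV q).trans_le hcθ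
  obtain ⟨hmem, hact⟩ := hU K n hnK V hVw
  set U : GaugeField (F.P K) 0 (Matrix.specialUnitaryGroup (Fin 2) ℂ) := D.Umin K (K - n) (D.triv K (K - n))
      (fieldShift (F.sitesPerDir_eq (m := F.m) (K := K) (j := K - n) (m' := F.m) (K' := n) (j' := 0) (by omega)) V) with hUdef
  -- the datum's minimiser IS a minimiser over (6)(ε₀)
  have hmin : IsMinOn (fun W : GaugeField (F.P K) 0 (Matrix.specialUnitaryGroup (Fin 2) ℂ) => wilsonAction4 W)
      (regFibrePr F n K hnK.le ε₀ V) U := by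
    intro W hW
    show wilsonAction4 U ≤ wilsonAction4 W
    rw [hact]
    exact minActionRegPr_le F hW
  -- hence in (8) at `ε₁ := θBal(c·b₀)(n) = c·θBal(n)`
  have hε₁ : 0 < θBal F.L γ (c * b₀) p₀ n := θBal_pos hL hγ hγ1 (mul_pos hc0 hb) p₀ n
  have h8 : U ∈ regFibrePr F n K hnK.le (B₃ * θBal F.L γ (c * b₀) p₀ n) V :=
    hIn8 F hF n K hnK _ ε₀ hε₁ (hθa₁ n) (hθε₀ n) hε₀a V hV U hmem hmin
  have hplaq : PlaqSmall (regThreshold F n K (B₃ * θBal F.L γ (c * b₀) p₀ n)) U := ((mem_regFibrePr_iff F).mp h8).2.1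
  have hBθ : B₃ * θBal F.L γ (c * b₀) p₀ n ≤ θBal F.L γ b₀ p₀ n := by
    rw [θBal_mul, ← mul_assoc]
    exact mul_le_of_le_one_left (θBal_pos hL hγ hγ1 hb p₀ n).le hcB
  have hχ : PlaqSmall (θBal F.L γ b₀ p₀ n * ((F.L : ℝ)⁻¹) ^ (2 * (K - n))) U := by
    refine fun q => (hplaq q).trans_le ?_
    show B₃ * θBal F.L γ (c * b₀) p₀ n * ((F.L : ℝ)⁻¹) ^ (2 * (K - n)) ≤ _
    exact mul_le_mul_of_nonneg_right hBθ (pow_nonneg (inv_nonneg.mpr (Nat.cast_nonneg _)) _)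
  -- membership in print's χ-set of level `K − n` (height `K − (K − n) = n`)
  simp only [atHeights, printChiSets]
  refine ⟨?_, fun _ => ?_⟩
  · rw [show K - (K - n) = n by omega]
    exact (plaqSmall_fieldShift F _ _ V).mpr hVw
  · rw [show K - (K - n) = n by omega]
    exact hχ

/-- **THE HYPOTHESIS `hT8` OF §4 FROM CRUX `MinimiserStabilityRegPr`'s VARIATIONAL OUTPUT, IN ONE LINE**: 19200's `variational_of_leaves_log` delivers attainment over (6)
at a window `(â₀, â₁)` and «minimisers over (6) lie in (8)» at a window `(a₀, a₁)`, one `B₃`; at the common window `(min â₀ a₀, min â₁ a₁, B₃)` both [Balaban1985Variational]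
Thm 1 in the global reading (`MinimiserPin.thm1GlobalMinAt_min_of_attained_of_in8`, p535477) and the (8)-clause for every minimiser hold — the pair §4 consumes (stub T of
skeleton v5k displays only the first). [cite: Balaban1985Variational, Thm 1 (8) p.279, Prop 7 p.299 and Prop 8 p.304] -/
theorem thm1In8_of_attained_of_in8 {L : ℕ} {â₀ â₁ a₀ a₁ B₃ : ℝ} (hâ₀ : 0 < â₀) (hâ₁ : 0 < â₁) (ha₀ : 0 < a₀) (ha₁ : 0 < a₁) (hB₃ : 0 < B₃)
    (hatt : MinSixAttainedAt L â₀ â₁ B₃) (hin8 : MinimisersIn8At L a₀ a₁ B₃) :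
    ∃ a₀' a₁' B₃' : ℝ, 0 < a₀' ∧ 0 < a₁' ∧ 0 < B₃' ∧ Thm1GlobalMinAt L a₀' a₁' B₃' ∧ MinimisersIn8At L a₀' a₁' B₃' :=
  ⟨min â₀ a₀, min â₁ a₁, B₃, lt_min hâ₀ ha₀, lt_min hâ₁ ha₁, hB₃, MinimiserPin.thm1GlobalMinAt_min_of_attained_of_in8 hatt hin8,
    MinimiserPin.minimisersIn8At_anti hin8 (min_le_right _ _) (min_le_right _ _)⟩

end Discharge

/-! ## §4 Block-size level: the v5kC §2 body, one chain for every odd `L` -/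

section BlockSize

/-- **`FluctuationComparisonRegPrIntL` ⇐ WINDOW POSITIVITY + (THM 1 ∃-form ∧ (8) ∀-form) + A DATUM WITH (41)∧(47) ON PRINT'S χ AND KING'S CAUCHY PROPERTY ON χ-GOOD DATA —
the record-free §2 of the R-57χ skeleton.**  Hypotheses, all in the route's prefix: `hT8` = for every odd `L > 1`, [Balaban1985Variational] Thm 1 in the tree's global
reading `Thm1GlobalMinAt L a₀ a₁ B₃` TOGETHER WITH its (8)-clause for EVERY minimiser `MinimisersIn8At L a₀ a₁ B₃` (both outputs of crux `MinimiserStabilityRegPr`'s registered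
leaves); `hData` = for every odd `L > 1`: thresholds `(b₁, p₁)`, then for every profile beyond them `ε₁`, for every `ε₀ ≤ ε₁` an `m₀`, for every `m ≥ m₀` a `γ₁`, and for every
family `F` with `F.L = L` and `0 < γ ≤ γ₁` a datum `D : AlphaDataT3 F γ` with (a) its trivial-history composite minimiser in print's space (6)(ε₀) attaining the regular
minimum at every height `n < K` of every window datum (v3: `dataOfV3_uminTriv`), (b) [Balaban1985UV3] (41)∧(47) pinned ON PRINT'S χ `atHeights (printChiSets D b₀ p₀)` (the
re-typed record's (A) through `twoSidedRepOn_of_oneStepTrivOn_printChi`), (c) King's cut-off-Cauchy property of `D.PintH` along the free fraction `m` ON the data χ-good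
for both runs with print's margin `μ_L = 1 − 2/(L√L)` ((i*)χ + `levelCauchyOnOfGlobalSupRateTSlackOn_dec` at `L < 7`; 3⁗χ + S-E″ + `pintCauchyOn_of_cauchyAt` at `L ≥ 7`);
`hPos` = positivity of both restricted densities on the window (verbatim the conclusion of `OneStepSubmersion.posOnSmall_of_oneStepSmallLift` ∘ STUB 1).  Conclusion:
`FluctuationComparisonRegPrIntL` with `c := (max B₃ 1)⁻¹`, `m₀ ≥ 2` — per family §2 at `S₁ :=` print's χ of `D.Umin` (discharged on the interior by §3) and
`S₂ := ChiGood(μ_L)` (discharged by `interior_chiGood_of_thm1GlobalMinAt`).  No edge clause, no `K = 0` corner, no block-size split.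
[cite: Balaban1985UV3, (41) p.266 and (47) p.267; Balaban1985Variational, Thm 1 (8) p.279; King1986, Prop. 3.8-3.9 pp.664-665] -/
theorem regPrIntL_of_dataOnPrintChi
    (hT8 : ∀ L : ℕ, Odd L → 1 < L → ∃ a₀ a₁ B₃ : ℝ, 0 < a₀ ∧ 0 < a₁ ∧ 0 < B₃ ∧
      Thm1GlobalMinAt L a₀ a₁ B₃ ∧ MinimisersIn8At L a₀ a₁ B₃)
    (hData : ∀ L : ℕ, Odd L → 1 < L → ∃ (b₁ p₁ : ℝ), ∀ (b₀ p₀ : ℝ), b₁ ≤ b₀ → p₁ ≤ p₀ → 0 < b₀ → 2 < p₀ →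
      ∃ ε₁ : ℝ, 0 < ε₁ ∧ ∀ (ε₀ : ℝ), 0 < ε₀ → ε₀ ≤ ε₁ → ∃ m₀ : ℕ, ∀ (m : ℕ), m₀ ≤ m →
        ∃ γ₁ : ℝ, 0 < γ₁ ∧ ∀ (F : T3Family) (γ : ℝ), F.L = L → 0 < γ → γ ≤ γ₁ →
          ∃ D : AlphaDataT3 F γ,
            (∀ (K n : ℕ) (hnK : n < K) (V : GaugeField (F.P n) 0 (Matrix.specialUnitaryGroup (Fin 2) ℂ)),
              PlaqSmall (θBal F.L γ b₀ p₀ n) V →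
                D.Umin K (K - n) (D.triv K (K - n))
                    (fieldShift (F.sitesPerDir_eq (m := F.m) (K := K) (j := K - n) (m' := F.m) (K' := n) (j' := 0) (by omega)) V) ∈
                  regFibrePr F n K hnK.le ε₀ V ∧
                wilsonAction4 (D.Umin K (K - n) (D.triv K (K - n))
                    (fieldShift (F.sitesPerDir_eq (m := F.m) (K := K) (j := K - n) (m' := F.m) (K' := n) (j' := 0) (by omega)) V)) =
                  minActionRegPr F n K hnK.le ε₀ V) ∧
            TwoSidedRepOn F γ b₀ p₀ (atHeights (printChiSets D b₀ p₀)) ε₀ D.PintH D.EcstH D.RmH ∧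
            PintCauchyOn F γ b₀ p₀
              (fun K n h V => ChiGood F γ b₀ p₀ ε₀ (1 - 2 / ((F.L : ℝ) * Real.sqrt F.L)) (n := n) (K := K) h V) m D.PintH)
    (hPos : ∀ (L m : ℕ), 0 < m → ∀ (b₀ p₀ : ℝ), 0 < b₀ → 2 < p₀ → ∃ γ₁ : ℝ, 0 < γ₁ ∧
      ∀ (F : T3Family) (γ : ℝ), F.L = L → 0 < γ → γ ≤ γ₁ →
        ∀ K, ∀ᵐ V ∂fieldMeasure (F.P (K / m)) 0 (Matrix.specialUnitaryGroup (Fin 2) ℂ),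
          PlaqSmall (θBal F.L γ b₀ p₀ (K / m)) V →
            0 < heightDensity F γ (Nat.div_le_self K m) (histGood F ℰp (θBal F.L γ b₀ p₀) K (K / m)) V ∧
            0 < heightDensity F γ ((Nat.div_le_self K m).trans (Nat.le_succ K))
                  (histGood F ℰp (θBal F.L γ b₀ p₀) (K + 1) (K / m)) V) :
    FluctuationComparisonRegPrIntL := by
  intro L
  by_cases hL : Odd L ∧ 1 < L
  swap
  · -- no family has this block size
    refine ⟨1, 0, 0, one_pos, le_rfl, fun b₀ p₀ _ _ _ _ => ⟨1, one_pos, fun ε₀ _ _ => ⟨0, fun m _ => ⟨1, one_pos, ?_⟩⟩⟩⟩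
    intro F γ hF
    exact absurd (hF ▸ F.hL : Odd L ∧ 1 < L) hL
  obtain ⟨a₀, a₁, B₃, ha₀, ha₁, hB₃, hT, hIn8⟩ := hT8 L hL.1 hL.2
  obtain ⟨b₁, p₁, hD⟩ := hData L hL.1 hL.2
  have hM : 0 < max B₃ 1 := lt_max_of_lt_right one_pos
  have hc0 : 0 < (max B₃ 1)⁻¹ := inv_pos.mpr hM
  have hc1 : (max B₃ 1)⁻¹ ≤ 1 := inv_le_one_of_one_le₀ (le_max_right _ _)
  have hcB : B₃ * (max B₃ 1)⁻¹ ≤ 1 := by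
    rw [← div_eq_mul_inv, div_le_one hM]
    exact le_max_left _ _
  refine ⟨(max B₃ 1)⁻¹, b₁, p₁, hc0, hc1, fun b₀ p₀ hb₁ hp₁ hb hp => ?_⟩
  obtain ⟨ε₁, hε₁, hD1⟩ := hD b₀ p₀ hb₁ hp₁ hb hp
  refine ⟨min ε₁ a₀, lt_min hε₁ ha₀, fun ε₀ hε₀ hε₀le => ?_⟩
  have hε₀1 : ε₀ ≤ ε₁ := hε₀le.trans (min_le_left _ _)
  have hε₀a : ε₀ ≤ a₀ := hε₀le.trans (min_le_right _ _)
  obtain ⟨m₀, hD2⟩ := hD1 ε₀ hε₀ hε₀1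
  refine ⟨max m₀ 2, fun m hm => ?_⟩
  have hm2 : 2 ≤ m := (le_max_right _ _).trans hm
  obtain ⟨γ₁, hγ₁, hD3⟩ := hD2 m ((le_max_left _ _).trans hm)
  -- (E1) the interior is `ChiGood(μ_L)` for both runs ([Balaban1985Variational] Thm 1, ∃-form)
  obtain ⟨γE, hγE, hγE1, hE1⟩ := interior_chiGood_of_thm1GlobalMinAt hL.2.le hT ha₁ hB₃ hb (zero_le_two.trans hp.le) hε₀
    hε₀a hc0 hcB
  -- (E2) thresholds of the (8)-discharge: `θBal(c·b₀) ≤ a₁`, `B₃θBal(c·b₀) ≤ ε₀`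
  obtain ⟨γI, hγI, hI⟩ := exists_forall_θBal_le hL.2.le ((max B₃ 1)⁻¹ * b₀) p₀ (lt_min ha₁ (div_pos hε₀ hB₃))
  obtain ⟨γP, hγP, hP⟩ := hPos L m (by omega) b₀ p₀ hb hp
  refine ⟨min (min γ₁ γE) (min γI γP), lt_min (lt_min hγ₁ hγE) (lt_min hγI hγP), fun F γ hF hγ hγle => ?_⟩
  have hγ₁' : γ ≤ γ₁ := hγle.trans ((min_le_left _ _).trans (min_le_left _ _))
  have hγE' : γ ≤ γE := hγle.trans ((min_le_left _ _).trans (min_le_right _ _))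
  have hγI' : γ ≤ γI := hγle.trans ((min_le_right _ _).trans (min_le_left _ _))
  have hγP' : γ ≤ γP := hγle.trans ((min_le_right _ _).trans (min_le_right _ _))
  have hγ1 : γ ≤ 1 := hγE'.trans hγE1
  obtain ⟨D, hU, hrep, hcau⟩ := hD3 F γ hF hγ hγ₁'
  have hcθ : ∀ i, θBal F.L γ ((max B₃ 1)⁻¹ * b₀) p₀ i ≤ θBal F.L γ b₀ p₀ i :=
    fun i => θBal_mul_le F.hL.2.le hγ hγ1 hb hc1 p₀ i
  have hI' : ∀ i, θBal F.L γ ((max B₃ 1)⁻¹ * b₀) p₀ i ≤ min a₁ (ε₀ / B₃) := by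
    have h := hI γ hγ hγI'
    rw [← hF] at h
    exact h
  have hθa₁ : ∀ i, θBal F.L γ ((max B₃ 1)⁻¹ * b₀) p₀ i ≤ a₁ := fun i => (hI' i).trans (min_le_left _ _)
  have hθε₀ : ∀ i, B₃ * θBal F.L γ ((max B₃ 1)⁻¹ * b₀) p₀ i ≤ ε₀ := fun i => by
    have h := (hI' i).trans (min_le_right _ _)
    rwa [le_div_iff₀ hB₃, mul_comm] at h
  have hm0 : 0 < m := by omega
  refine fluctuationComparisonRegPrIntAt_of_repOn_cauchyOn_interior hm0 _ _ hrep hcau hcθ (fun K hK => ?_) (fun K hK => ?_)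
    (fun K hK => ?_)
  · -- the interior is print-χ-good for `D.Umin`, both runs (§3; deterministic)
    have hlt : K / m < K := Nat.div_lt_self hK (by omega)
    have hlt' : K / m < K + 1 := hlt.trans (Nat.lt_succ_self K)
    exact Filter.Eventually.of_forall fun V hs =>
      ⟨atHeights_printChiSets_of_interior hIn8 hF hγ hγ1 hb hc0 hc1 hcB hε₀a hθa₁ hθε₀ hU hlt V hs,
        atHeights_printChiSets_of_interior hIn8 hF hγ hγ1 hb hc0 hc1 hcB hε₀a hθa₁ hθε₀ hU hlt' V hs⟩
  · -- the interior is `ChiGood(μ_L)`, both runs ((E1); deterministic)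
    have hlt : K / m < K := Nat.div_lt_self hK (by omega)
    have hlt' : K / m < K + 1 := hlt.trans (Nat.lt_succ_self K)
    exact Filter.Eventually.of_forall fun V hs => ⟨hE1 F γ hF hγ hγE' hlt V hs, hE1 F γ hF hγ hγE' hlt' V hs⟩
  · -- positivity on the interior from positivity on the window
    filter_upwards [hP F γ hF hγ hγP' K] with V hpV hs
    exact hpV (fun q => (hs q).trans_le (hcθ _))

/-- **The same with the FULL-window Cauchy property** `CauchyAtHeights D b₀ p₀ m` in (c) (what 3⁗χ + S-E″ `GlobalSlack.levelCauchyOfGlobalSupRateTSlack_dec` deliver at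
`L ≥ 7`): restricted to the `ChiGood(μ_L)`-good data by `pintCauchyOn_of_cauchyAt`. [cite: King1986, Thm 3.4 (3.9) p.656 and Prop. 3.8-3.9 pp.664-665] -/
theorem regPrIntL_of_dataOnPrintChi_cauchyFull
    (hT8 : ∀ L : ℕ, Odd L → 1 < L → ∃ a₀ a₁ B₃ : ℝ, 0 < a₀ ∧ 0 < a₁ ∧ 0 < B₃ ∧
      Thm1GlobalMinAt L a₀ a₁ B₃ ∧ MinimisersIn8At L a₀ a₁ B₃)
    (hData : ∀ L : ℕ, Odd L → 1 < L → ∃ (b₁ p₁ : ℝ), ∀ (b₀ p₀ : ℝ), b₁ ≤ b₀ → p₁ ≤ p₀ → 0 < b₀ → 2 < p₀ →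
      ∃ ε₁ : ℝ, 0 < ε₁ ∧ ∀ (ε₀ : ℝ), 0 < ε₀ → ε₀ ≤ ε₁ → ∃ m₀ : ℕ, ∀ (m : ℕ), m₀ ≤ m →
        ∃ γ₁ : ℝ, 0 < γ₁ ∧ ∀ (F : T3Family) (γ : ℝ), F.L = L → 0 < γ → γ ≤ γ₁ →
          ∃ D : AlphaDataT3 F γ,
            (∀ (K n : ℕ) (hnK : n < K) (V : GaugeField (F.P n) 0 (Matrix.specialUnitaryGroup (Fin 2) ℂ)),
              PlaqSmall (θBal F.L γ b₀ p₀ n) V →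
                D.Umin K (K - n) (D.triv K (K - n))
                    (fieldShift (F.sitesPerDir_eq (m := F.m) (K := K) (j := K - n) (m' := F.m) (K' := n) (j' := 0) (by omega)) V) ∈
                  regFibrePr F n K hnK.le ε₀ V ∧
                wilsonAction4 (D.Umin K (K - n) (D.triv K (K - n))
                    (fieldShift (F.sitesPerDir_eq (m := F.m) (K := K) (j := K - n) (m' := F.m) (K' := n) (j' := 0) (by omega)) V)) =
                  minActionRegPr F n K hnK.le ε₀ V) ∧
            TwoSidedRepOn F γ b₀ p₀ (atHeights (printChiSets D b₀ p₀)) ε₀ D.PintH D.EcstH D.RmH ∧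
            CauchyAtHeights D b₀ p₀ m)
    (hPos : ∀ (L m : ℕ), 0 < m → ∀ (b₀ p₀ : ℝ), 0 < b₀ → 2 < p₀ → ∃ γ₁ : ℝ, 0 < γ₁ ∧
      ∀ (F : T3Family) (γ : ℝ), F.L = L → 0 < γ → γ ≤ γ₁ →
        ∀ K, ∀ᵐ V ∂fieldMeasure (F.P (K / m)) 0 (Matrix.specialUnitaryGroup (Fin 2) ℂ),
          PlaqSmall (θBal F.L γ b₀ p₀ (K / m)) V →
            0 < heightDensity F γ (Nat.div_le_self K m) (histGood F ℰp (θBal F.L γ b₀ p₀) K (K / m)) V ∧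
            0 < heightDensity F γ ((Nat.div_le_self K m).trans (Nat.le_succ K))
                  (histGood F ℰp (θBal F.L γ b₀ p₀) (K + 1) (K / m)) V) :
    FluctuationComparisonRegPrIntL := by
  refine regPrIntL_of_dataOnPrintChi hT8 (fun L hLo hL => ?_) hPos
  obtain ⟨b₁, p₁, hD⟩ := hData L hLo hL
  refine ⟨b₁, p₁, fun b₀ p₀ hb₁ hp₁ hb hp => ?_⟩
  obtain ⟨ε₁, hε₁, hD1⟩ := hD b₀ p₀ hb₁ hp₁ hb hp
  refine ⟨ε₁, hε₁, fun ε₀ hε₀ hε₀le => ?_⟩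
  obtain ⟨m₀, hD2⟩ := hD1 ε₀ hε₀ hε₀le
  refine ⟨m₀, fun m hm => ?_⟩
  obtain ⟨γ₁, hγ₁, hD3⟩ := hD2 m hm
  refine ⟨γ₁, hγ₁, fun F γ hF hγ hγle => ?_⟩
  obtain ⟨D, hU, hrep, hcau⟩ := hD3 F γ hF hγ hγle
  exact ⟨D, hU, hrep, pintCauchyOn_of_cauchyAt _ hcau⟩

end BlockSize

end Summit.QuantumFields.YangMills.Theorems.InteriorExcision

end
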